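import Summits.QuantumFields.YangMills.Theorems.BalabanUVNodesN07MinTokensLandauOfRows
import Summits.QuantumFields.YangMills.Theorems.BalabanUVNodesN07KnitTokensLandauTwoOfRowsReal
import Summits.QuantumFields.YangMills.Theorems.BalabanUVNodesN07H1LandauRowAtRecord
import HarnessLib

/-!
# N07 ∕ K0ᴬ — THE KNIT CONSUMER STATEMENTS WITH THE LANDAU ROW OF `𝔄` DISCHARGED: ✓`minTokens_landau_of_rows` (any `N`) and ✓`knitTokens_landau_two_of_rows_real` (`N = 2`) with «`RD*(S.𝔄 V) = 0`»
# replaced by def-Y's G′-datum rows (g5) «`G′(Δλ) = λ` on `N(Q′♭)`» and (g2) «`Q(U₀)(D_{U₀}λ) = 0` on `N(Q′♭)`» via ✓`RDstar_iota_frakAOfRecordAtBg128_eq_zero` (LANDED-13)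

Cell `pub-ymgap`, seat `pub-ymgap-dag-n07-w3` (g29, WIDTH SEAT 3 on N07 [B11] = [15]); helper file keyed `--kind proof --supports stmt-QuantumFields-27238 --as helper` (K0ᴬ road);
count-neutral.  INTENT-14 of the seat.

## What is here

* ★★★ `minTokens_landau_of_g5` (any `N`): (min) ∧ (c→s) for `Kc^L_ρ` at `𝔖♭.chartLin T♭`; displayed: standard rows, numerics, Sect. C `RC`∕`hC`, `hsym`, `Delta2Tok`-shape, **(g5)**, **(g2)**, `T47` reality∕trace
  rows on `evHerm0 ∩ 𝔏`, THE F-H ROW.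
* ★★★ `knitTokens_landau_two_of_g5` (`N = 2`): (rng) ∧ (star_mem) ∧ (min) ∧ (c→s); displayed: file 4's rows, `HessSymmTok`, `Delta2Tok`, **(g5)**, **(g2)**, THE F-H ROW.

## Honest labels

As LANDED-10…13: the F-H row is false for `H₁♭` off the flat locus (RR-2's TRACE FLAG F-H) ⇒ vacuous there by design; for the `π`-type charts it is ✓`RDstar_iota_Emap_H1OfRecordAtBg128_eq_zero`
(LANDED-13) — the re-key is def-Y's.  Nothing of Bałaban's estimates proved; K0ᴬ ⟨27238⟩ NOT closed; N07 NOT discharged; COUNT∕K UNMOVED; R4 is the conditional finite-𝕋⁴ rung `BalabanLadder.UV`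
only; finite torus at fixed `ε` — nothing continuum ∕ OS ∕ Clay.  **The Yang–Mills mass gap is NOT proved by any of this.**  No `sorry`, no `def`, no `instance ∕ notation ∕ set_option`; standard axioms.
[cite: Balaban1985Variational, Thm 1 p.279, Prop. 5 p.294, Prop. 6 p.295, Prop. 7 p.299, (45)–(47) p.285, (74)–(84) pp.289–290, (100)–(111) pp.293–294; Balaban1985BackgroundPropagators, (3.119) p.419, (3.124)–(3.128) pp.420–421; Balaban1987RG1, (0.21) p.256]
-/

noncomputable section

open Set Metric Filter Topology
open scoped Matrix Matrix.Norms.L2Operator InnerProductSpace ComplexConjugate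

namespace Summit.QuantumFields.YangMills.Theorems.N07KnitTokensLandauOfG5

open Literature.MathematicalPhysics.QuantumFieldTheory.Balaban1983to89
open Literature.MathematicalPhysics.QuantumFieldTheory.Balaban1983to89.T4Continuum (T4Family)
open Literature.MathematicalPhysics.QuantumFieldTheory.Balaban1983to89.Node00
open B9Eq311TracePairing (starW)
open B11Eq103H1Complex (SiteL2K BondL2K readFun funEquiv QFun covDivL2K covDerivL2K covLaplaceSiteK)
open B11Eq111FrakG (nabla115)
open B11Eq115Space (NegSize NegSup JetSup)
open B11Eq174Chart (Regime)
open B11Prop6Scheme (Prop4Hyp mapT)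
open B11Eq90Transpose (pair27)
open B11Eq90V0primeCurrent (flat115)
open B11Eq90V0GroupComposed (T47)
open B11Eq80Current (Emap quadPart)
open B9Eq3119DeltaPiCarrier (currentCLM)
open Summit.QuantumFields.YangMills.Theorems.N07TraceSectorDefs (scalPartW)
open Summit.QuantumFields.YangMills.Theorems.N07MinTokensLandauOfRows (minTokens_landau_of_rows)
open Summit.QuantumFields.YangMills.Theorems.N07KnitTokensLandauTwoOfRowsReal (knitTokens_landau_two_of_rows_real)
open Summit.QuantumFields.YangMills.Theorems.N07KnitTokensLandauTwoOfEq81 (hessOpOfRecord128_symm_of_hessSymmTok)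
open Summit.QuantumFields.YangMills.Theorems.N07H1LandauRowAtRecord (RDstar_iota_frakAOfRecordAtBg128_eq_zero)

/-! ## §1  Any `N` -/

section AnyN

variable (F : T4Family) (N : ℕ) [NeZero N] {K : ℕ} (k : ℕ) (Ω : ℕ → Set (Site (F.P K) 0)) (U₀ : GaugeField (F.P K) 0 (SU N))
  [Fact (0 < (F.L : ℝ))] [Fact (0 < (F.P K).eta k)] (levB : PBond (F.P K) k → ℕ) [Fact (0 < c0Rec F K k)] [Fact (∀ c, 0 < wBRec F K k c)] (a : ℝ)
  (hposb : ∀ x, x ≠ 0 → 0 < RCLike.re ⟪x, laplaceAOfRecord F N k U₀ (QOfRecord F N k U₀) (QflatOfRecord F N k) a x⟫_ℂ)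
  (hQ : Function.Surjective (QOfRecord F N k U₀)) (εC : ℝ)
  (Gp : SiteL2K ℂ (F.P K).d (fun _ => (F.P K).sitesPerDir 0) (c0Rec F K k) (WRec N) →ₗ[ℂ]
    SiteL2K ℂ (F.P K).d (fun _ => (F.P K).sitesPerDir 0) (c0Rec F K k) (WRec N))
  (Δ2 : BondL2K ℂ (F.P K).d (fun _ => (F.P K).sitesPerDir 0) (c0Rec F K k) (WRec N) →ₗ[ℂ]
    BondL2K ℂ (F.P K).d (fun _ => (F.P K).sitesPerDir 0) (c0Rec F K k) (WRec N))
  (hposπ : ∀ x, x ≠ 0 → 0 < RCLike.re ⟪x, laplaceAOfRecordAt F N k U₀ (hessOpOfRecord128 F N k U₀ Gp (QflatOfRecord F N k) Δ2)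
    (QOfRecord F N k U₀) (QflatOfRecord F N k) a x⟫_ℂ)
  {b C₂ c₄ aC : ℝ}
  (RC : Regime (H1OfRecordAtBgFlat F N K k Ω U₀ levB a hposb hQ) 0 (CslOfRecord F N K k Ω U₀ levB) b 0 C₂ c₄ 0 aC εC)
  (hC : Prop4Hyp (CslOfRecord F N K k Ω U₀ levB) C₂ c₄)
  (ι : Space115Lit F N K k Ω U₀ ≃ₗ[ℂ] BondL2K ℂ (F.P K).d (fun _ => (F.P K).sitesPerDir 0) (c0Rec F K k) (WRec N))
  (hι : ∀ y, ι y = (funEquiv (phiRec N) (fun _ : B9SectCLatticeCarrier.Bond (F.P K).d (fun _ => (F.P K).sitesPerDir 0) => c0Rec F K k)).symm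
    (JetSup.equiv _ _ (nabla115 ((F.P K).eta k) (unitsOfRecord F N U₀)) y))

include hι RC hC in
/-- ★★★ **(min) ∧ (c→s), ANY `N`, WITH THE LANDAU ROW OF `𝔄` DISCHARGED BY (g5)+(g2)** (✓`minTokens_landau_of_rows` ∘ ✓`RDstar_iota_frakAOfRecordAtBg128_eq_zero`).
[cite: Balaban1985Variational, Thm 1 p.279, Prop. 6 p.295, (45) p.285, (74)–(84) pp.289–290; Balaban1985BackgroundPropagators, (3.124) p.420] -/
theorem minTokens_landau_of_g5
    (hsym : ∀ x y, ⟪hessOpOfRecord128 F N k U₀ Gp (QflatOfRecord F N k) Δ2 x, y⟫_ℂ = ⟪x, hessOpOfRecord128 F N k U₀ Gp (QflatOfRecord F N k) Δ2 y⟫_ℂ)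
    (hΔ2 : ∀ A' : Space115Lit F N K k Ω U₀,
      pair27 (tauRecCLM N) (currentCLM (phiRec N) (pairLevLit F Ω k) (nabla115 ((F.P K).eta k) (unitsOfRecord F N U₀)) Δ2 A') (flat115 A') =
        -2 * pair27 (tauRecCLM N) (JOfRecordAtBg F N K k Ω U₀)
          (flat115 (H1OfRecordAtBgFlat F N K k Ω U₀ levB a hposb hQ (quadPart (CslOfRecord F N K k Ω U₀ levB) A'))))
    (g5 : (∀ l : SiteL2K ℂ (F.P K).d (fun _ => (F.P K).sitesPerDir 0) (c0Rec F K k) (WRec N), QflatOfRecord F N k l = 0 →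
      Gp (covLaplaceSiteK (cRec F K k) (RRec F N U₀) (SRec F N U₀) l) = l))
    (g2 : (∀ l : SiteL2K ℂ (F.P K).d (fun _ => (F.P K).sitesPerDir 0) (c0Rec F K k) (WRec N), QflatOfRecord F N k l = 0 →
      QOfRecord F N k U₀ (covDerivL2K ℂ (c0Rec F K k) (cRec F K k) (RRec F N U₀) l) = 0)) :
    ∃ M γ : ℝ, 0 ≤ M ∧ 0 < γ ∧
      ∀ (dom : Set (GaugeField (F.P K) k (SU N))) (B₀ C₄ a₃ j a𝔄 ε₄ ρ : ℝ)
        (S : BgSchemeOnLit F N K k Ω U₀) (_hS : S = bgSchemeOfRecord F N K k Ω U₀ dom levB Gp Δ2 a hposπ hposb hQ εC B₀ C₄ a₃ j a𝔄 ε₄),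
        ρ ≤ aC → ε₄ + a𝔄 ≤ ρ → 2 * (ρ + a𝔄 + a𝔄) ≤ a₃ → 4 * M * B₀ * C₄ * (ρ + a𝔄 + a𝔄) < γ →
        S.RegimeTok → FrakGSliceTok F N K k Ω U₀ Gp Δ2 a hposπ hQ → (∀ V ∈ dom, S.LieTokAt V) →
        (∀ A' : Space115Lit F N K k Ω U₀, A' ∈ S.evHerm0 → RrOfRecord F N k U₀ (QflatOfRecord F N k) (covDivL2K ℂ (c0Rec F K k) (cRec F K k) (SRec F N U₀) (ι A')) = 0 → ‖A'‖ < ρ →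
          (∀ b', star (JetSup.equiv _ _ (nabla115 ((F.P K).eta k) (unitsOfRecord F N U₀)) (T47 (H1OfRecordAtBgFlat F N K k Ω U₀ levB a hposb hQ) (CslOfRecord F N K k Ω U₀ levB) εC A') b') =
            JetSup.equiv _ _ (nabla115 ((F.P K).eta k) (unitsOfRecord F N U₀)) (T47 (H1OfRecordAtBgFlat F N K k Ω U₀ levB a hposb hQ) (CslOfRecord F N K k Ω U₀ levB) εC A') b') ∧
          (∀ b', Matrix.trace (JetSup.equiv _ _ (nabla115 ((F.P K).eta k) (unitsOfRecord F N U₀)) (T47 (H1OfRecordAtBgFlat F N K k Ω U₀ levB a hposb hQ) (CslOfRecord F N K k Ω U₀ levB) εC A') b') = 0)) →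
        (∀ A' : Space115Lit F N K k Ω U₀, A' ∈ S.evHerm0 → RrOfRecord F N k U₀ (QflatOfRecord F N k) (covDivL2K ℂ (c0Rec F K k) (cRec F K k) (SRec F N U₀) (ι A')) = 0 → ‖A'‖ < ρ →
          RrOfRecord F N k U₀ (QflatOfRecord F N k) (covDivL2K ℂ (c0Rec F K k) (cRec F K k) (SRec F N U₀) (ι (Emap (H1OfRecordAtBgFlat F N K k Ω U₀ levB a hposb hQ) (CslOfRecord F N K k Ω U₀ levB) εC A'))) = 0) →
        (∀ V ∈ dom, IsMinOn (wilsonAction4 ∘ S.chartLin (fun _ => T47 (H1OfRecordAtBgFlat F N K k Ω U₀ levB a hposb hQ) (CslOfRecord F N K k Ω U₀ levB) εC) V) {A : Space115Lit F N K k Ω U₀ | A ∈ constraint102OfRecord F N K k Ω U₀ ∧ A + S.𝔄 V ∈ S.evHerm0 ∧ ‖A + S.𝔄 V‖ < ρ} (S.sol V)) ∧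
        (∀ V ∈ dom, ∀ A ∈ {A : Space115Lit F N K k Ω U₀ | A ∈ constraint102OfRecord F N K k Ω U₀ ∧ A + S.𝔄 V ∈ S.evHerm0 ∧ ‖A + S.𝔄 V‖ < ρ},
          IsMinOn (wilsonAction4 ∘ S.chartLin (fun _ => T47 (H1OfRecordAtBgFlat F N K k Ω U₀ levB a hposb hQ) (CslOfRecord F N K k Ω U₀ levB) εC) V) {A : Space115Lit F N K k Ω U₀ | A ∈ constraint102OfRecord F N K k Ω U₀ ∧ A + S.𝔄 V ∈ S.evHerm0 ∧ ‖A + S.𝔄 V‖ < ρ} A → ‖A‖ ≤ S.ε₄ ∧ mapT (S.𝒢 V) 0 (S.W V) (S.J V) (S.𝔄 V) A = A) := by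
  obtain ⟨M, γ, hM, hγ, hmin⟩ := minTokens_landau_of_rows F N k Ω U₀ levB a hposb hQ εC Gp Δ2 hposπ RC hC ι hι hsym hΔ2
  refine ⟨M, γ, hM, hγ, ?_⟩
  intro dom B₀ C₄ a₃ j a𝔄 ε₄ ρ S hS hρaC hfit hdom hnum hR h𝔊 hL hT47 hFH
  refine hmin dom B₀ C₄ a₃ j a𝔄 ε₄ ρ S hS hρaC hfit hdom hnum hR h𝔊 hL ?_ hT47 hFH
  intro V _
  subst hS
  simpa only [bgSchemeOfRecord_𝔄] using RDstar_iota_frakAOfRecordAtBg128_eq_zero F N k Ω U₀ levB Gp Δ2 a hposπ hQ ι hι hsym g5 g2 V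

end AnyN

/-! ## §2  `N = 2` -/

section Two

variable (F : T4Family) {K : ℕ} (k : ℕ) (Ω : ℕ → Set (Site (F.P K) 0)) (U₀ : GaugeField (F.P K) 0 (SU 2))
  [Fact (0 < (F.L : ℝ))] [Fact (0 < (F.P K).eta k)] (levB : PBond (F.P K) k → ℕ) [Fact (0 < c0Rec F K k)] [Fact (∀ c, 0 < wBRec F K k c)] (a : ℝ)
  (hposb : ∀ x, x ≠ 0 → 0 < RCLike.re ⟪x, laplaceAOfRecord F 2 k U₀ (QOfRecord F 2 k U₀) (QflatOfRecord F 2 k) a x⟫_ℂ)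
  (hQ : Function.Surjective (QOfRecord F 2 k U₀)) {b C₂ c₄ aC εC : ℝ}
  (RC : Regime (H1OfRecordAtBgFlat F 2 K k Ω U₀ levB a hposb hQ) 0 (CslOfRecord F 2 K k Ω U₀ levB) b 0 C₂ c₄ 0 aC εC)
  (hCreal : ∀ A : Space115Lit F 2 K k Ω U₀,
    ((JetSup.equiv _ _ (nabla115 ((F.P K).eta k) (unitsOfRecord F 2 U₀))).symm
        (star (JetSup.equiv _ _ (nabla115 ((F.P K).eta k) (unitsOfRecord F 2 U₀)) A)) : Space115Lit F 2 K k Ω U₀) = A →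
    ‖A‖ ≤ εC + aC → ((NegSup.equiv _ _).symm (star (NegSup.equiv _ _ (CslOfRecord F 2 K k Ω U₀ levB A))) :
      NegSize (F.L : ℝ) ((F.P K).eta k) levB 0 (Matrix (Fin 2) (Fin 2) ℂ)) = CslOfRecord F 2 K k Ω U₀ levB A)
  (hCtr : ∀ A : Space115Lit F 2 K k Ω U₀,
    ((JetSup.equiv _ _ (nabla115 ((F.P K).eta k) (unitsOfRecord F 2 U₀))).symm
        (star (JetSup.equiv _ _ (nabla115 ((F.P K).eta k) (unitsOfRecord F 2 U₀)) A)) : Space115Lit F 2 K k Ω U₀) = A →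
    (∀ b, (JetSup.equiv _ _ (nabla115 ((F.P K).eta k) (unitsOfRecord F 2 U₀)) A b).trace = 0) →
    ‖A‖ ≤ εC + aC → ∀ c, (NegSup.equiv _ _ (CslOfRecord F 2 K k Ω U₀ levB A) c).trace = 0)
  (Gp : SiteL2K ℂ (F.P K).d (fun _ => (F.P K).sitesPerDir 0) (c0Rec F K k) (WRec 2) →ₗ[ℂ]
    SiteL2K ℂ (F.P K).d (fun _ => (F.P K).sitesPerDir 0) (c0Rec F K k) (WRec 2))
  (Δ2 : BondL2K ℂ (F.P K).d (fun _ => (F.P K).sitesPerDir 0) (c0Rec F K k) (WRec 2) →ₗ[ℂ]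
    BondL2K ℂ (F.P K).d (fun _ => (F.P K).sitesPerDir 0) (c0Rec F K k) (WRec 2))
  (hposπ : ∀ x, x ≠ 0 → 0 < RCLike.re ⟪x, laplaceAOfRecordAt F 2 k U₀ (hessOpOfRecord128 F 2 k U₀ Gp (QflatOfRecord F 2 k) Δ2)
    (QOfRecord F 2 k U₀) (QflatOfRecord F 2 k) a x⟫_ℂ)


include RC hCreal hCtr in
/-- ★★★ **THE FOUR KNIT TOKENS AT `N = 2` FOR THE LANDAU FAMILY WITH THE LANDAU ROW OF `𝔄` DISCHARGED BY (g5)+(g2)** (✓`knitTokens_landau_two_of_rows_real` ∘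
✓`RDstar_iota_frakAOfRecordAtBg128_eq_zero`, `HessSymmTok` ⟹ symmetry by ✓`hessOpOfRecord128_symm_of_hessSymmTok`).  Displayed def-Y-side rows: `HessSymmTok`, `Delta2Tok`, (g5), (g2), THE F-H ROW.
[cite: Balaban1985Variational, Thm 1 p.279, Prop. 6 p.295, (45) p.285, (74)–(84) pp.289–290, (100)–(111) pp.293–294; Balaban1985BackgroundPropagators, (3.124)–(3.128) pp.420–421] -/
theorem knitTokens_landau_two_of_g5 (h : SmallBelow (avOfRecord F 2 K) k U₀) {ε : ℝ} (hU₀reg : U₀ ∈ bgReg F 2 K k ε)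
    (hC : Prop4Hyp (CslOfRecord F 2 K k Ω U₀ levB) C₂ c₄) (haC : 0 < aC)
    (ι : Space115Lit F 2 K k Ω U₀ ≃ₗ[ℂ] BondL2K ℂ (F.P K).d (fun _ => (F.P K).sitesPerDir 0) (c0Rec F K k) (WRec 2))
    (hι : ∀ y, ι y = (funEquiv (phiRec 2) (fun _ : B9SectCLatticeCarrier.Bond (F.P K).d (fun _ => (F.P K).sitesPerDir 0) => c0Rec F K k)).symm
      (JetSup.equiv _ _ (nabla115 ((F.P K).eta k) (unitsOfRecord F 2 U₀)) y))
    (hsym : HessSymmTok F 2 K k U₀ Δ2) (hΔ2 : Delta2Tok F 2 K k Ω U₀ levB a hposb hQ Δ2)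
    (g5 : ∀ l : SiteL2K ℂ (F.P K).d (fun _ => (F.P K).sitesPerDir 0) (c0Rec F K k) (WRec 2), QflatOfRecord F 2 k l = 0 →
      Gp (covLaplaceSiteK (cRec F K k) (RRec F 2 U₀) (SRec F 2 U₀) l) = l)
    (g2 : ∀ l : SiteL2K ℂ (F.P K).d (fun _ => (F.P K).sitesPerDir 0) (c0Rec F K k) (WRec 2), QflatOfRecord F 2 k l = 0 →
      QOfRecord F 2 k U₀ (covDerivL2K ℂ (c0Rec F K k) (cRec F K k) (RRec F 2 U₀) l) = 0) :
    ∃ ρ₀ M γ : ℝ, 0 < ρ₀ ∧ ρ₀ ≤ aC ∧ 0 ≤ M ∧ 0 < γ ∧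
      ∀ (dom : Set (GaugeField (F.P K) k (SU 2))) (B₀ C₄ a₃ j a𝔄 ε₄ ρ : ℝ)
        (S : BgSchemeOnLit F 2 K k Ω U₀) (_hS : S = bgSchemeOfRecord F 2 K k Ω U₀ dom levB Gp Δ2 a hposπ hposb hQ εC B₀ C₄ a₃ j a𝔄 ε₄),
        ρ ≤ ρ₀ → ε₄ + a𝔄 ≤ ρ → 2 * (ρ + a𝔄 + a𝔄) ≤ a₃ → 4 * M * B₀ * C₄ * (ρ + a𝔄 + a𝔄) < γ →
        dom ⊆ logDiscOfRecord F 2 K k U₀ → S.RegimeTok → FrakGSliceTok F 2 K k Ω U₀ Gp Δ2 a hposπ hQ → (∀ V ∈ dom, S.LieTokAt V) →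
        -- THE F-H ROW: `RD*(H₁♭ D(A′)) = 0` on the Landau ball (print's (45) 2nd row ∘ (76); NOT a theorem for `H₁♭` off the flat locus — RR-2's TRACE FLAG F-H)
        (∀ A' : Space115Lit F 2 K k Ω U₀, A' ∈ S.evHerm0 → RrOfRecord F 2 k U₀ (QflatOfRecord F 2 k) (covDivL2K ℂ (c0Rec F K k) (cRec F K k) (SRec F 2 U₀) (ι A')) = 0 → ‖A'‖ < ρ₀ →
          RrOfRecord F 2 k U₀ (QflatOfRecord F 2 k) (covDivL2K ℂ (c0Rec F K k) (cRec F K k) (SRec F 2 U₀) (ι (Emap (H1OfRecordAtBgFlat F 2 K k Ω U₀ levB a hposb hQ) (CslOfRecord F 2 K k Ω U₀ levB) εC A'))) = 0) →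
        -- (rng)
        (∀ V ∈ S.dom, ∀ A ∈ {A : Space115Lit F 2 K k Ω U₀ | A ∈ constraint102OfRecord F 2 K k Ω U₀ ∧ A + S.𝔄 V ∈ S.evHerm0 ∧ ‖A + S.𝔄 V‖ < ρ},
          S.chartLin (fun _ => T47 (H1OfRecordAtBgFlat F 2 K k Ω U₀ levB a hposb hQ) (CslOfRecord F 2 K k Ω U₀ levB) εC) V A ∈ bgReg F 2 K k ε ∧
          Averaging.iter (avOfRecord F 2 K) k
            (S.chartLin (fun _ => T47 (H1OfRecordAtBgFlat F 2 K k Ω U₀ levB a hposb hQ) (CslOfRecord F 2 K k Ω U₀ levB) εC) V A) = V) ∧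
        -- (star_mem)
        (∀ V ∈ S.dom, S.sol V ∈ {A : Space115Lit F 2 K k Ω U₀ | A ∈ constraint102OfRecord F 2 K k Ω U₀ ∧ A + S.𝔄 V ∈ S.evHerm0 ∧ ‖A + S.𝔄 V‖ < ρ}) ∧
        -- (min)
        (∀ V ∈ S.dom, IsMinOn (wilsonAction4 ∘ S.chartLin
              (fun _ => T47 (H1OfRecordAtBgFlat F 2 K k Ω U₀ levB a hposb hQ) (CslOfRecord F 2 K k Ω U₀ levB) εC) V)
            {A : Space115Lit F 2 K k Ω U₀ | A ∈ constraint102OfRecord F 2 K k Ω U₀ ∧ A + S.𝔄 V ∈ S.evHerm0 ∧ ‖A + S.𝔄 V‖ < ρ} (S.sol V)) ∧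
        -- (c→s)
        (∀ V ∈ S.dom, ∀ A ∈ {A : Space115Lit F 2 K k Ω U₀ | A ∈ constraint102OfRecord F 2 K k Ω U₀ ∧ A + S.𝔄 V ∈ S.evHerm0 ∧ ‖A + S.𝔄 V‖ < ρ},
          IsMinOn (wilsonAction4 ∘ S.chartLin
              (fun _ => T47 (H1OfRecordAtBgFlat F 2 K k Ω U₀ levB a hposb hQ) (CslOfRecord F 2 K k Ω U₀ levB) εC) V)
            {A : Space115Lit F 2 K k Ω U₀ | A ∈ constraint102OfRecord F 2 K k Ω U₀ ∧ A + S.𝔄 V ∈ S.evHerm0 ∧ ‖A + S.𝔄 V‖ < ρ} A →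
          ‖A‖ ≤ S.ε₄ ∧ mapT (S.𝒢 V) 0 (S.W V) (S.J V) (S.𝔄 V) A = A) := by
  obtain ⟨ρ₀, M, γ, hρ₀, hρ₀aC, hM, hγ, hmain⟩ :=
    knitTokens_landau_two_of_rows_real F k Ω U₀ levB a hposb hQ RC hCreal hCtr Gp Δ2 hposπ h hU₀reg hC haC ι hι hsym hΔ2
  refine ⟨ρ₀, M, γ, hρ₀, hρ₀aC, hM, hγ, ?_⟩
  intro dom B₀ C₄ a₃ j a𝔄 ε₄ ρ S hS hρ hfit hdom hnum hdisc hR h𝔊 hL hFH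
  refine hmain dom B₀ C₄ a₃ j a𝔄 ε₄ ρ S hS hρ hfit hdom hnum hdisc hR h𝔊 hL ?_ hFH
  intro V _
  subst hS
  simpa only [bgSchemeOfRecord_𝔄] using RDstar_iota_frakAOfRecordAtBg128_eq_zero F 2 k Ω U₀ levB Gp Δ2 a hposπ hQ ι hι
    (hessOpOfRecord128_symm_of_hessSymmTok F 2 k U₀ Gp (QflatOfRecord F 2 k) hsym) g5 g2 V

end Two

end Summit.QuantumFields.YangMills.Theorems.N07KnitTokensLandauOfG5

end
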